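import Summits.BirchSwinnertonDyer.BirchSwinnertonDyer.Theorems.EisensteinPrimesMazurMCOnX1RankZeroInterludeSelmerIsogenyMaps
import Literature.NumberTheory.EllipticCurves.Kato2004.DivisibilityInputsZetaLine
import Literature.NumberTheory.EllipticCurves.KatoDivisibilityColemanKernelSkeletonProofs
import Literature.NumberTheory.EllipticCurves.IsogenyDualProofs
import Literature.NumberTheory.EllipticCurves.IsogenyGroundFieldExtension
import Literature.NumberTheory.EllipticCurves.Rank1Residual.X1MainConjecture
import Literature.NumberTheory.QuadraticFields.HeegnerCondition
import HarnessLib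

/-!
# Crux `MazurMCOnX1RankZero` (item stmt-BirchSwinnertonDyer-19035), line `interlude_with_torsion`:
# finite-kernel and length-transfer lemmas for `Sel_𝔭^Σ(K_∞, f)` along isogenies, and K2⁺-e —
# ISOGENY INVARIANCE OF `𝔛_Gr(·/K_∞⁺)` AWAY FROM `(p)`

Cell `bsd-eis` (host `run/shared/lean/pub/bsd-eis/`), LEAD `cruxlead-19035` (g0); `--supports`
stmt-BirchSwinnertonDyer-19035 as a HELPER. Content = §K2e (D) + the REV 8.3–8.5 `K2e` additions + the theorem
`xGrIsogenyAwayFromP_proved` of the bsd-idea-11 supplement line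
`Cruxes/MazurMCOnX1RankZero/Lines/interlude_stepsTwoThree_split_idea11g6.lean` (mathematics by seat bsd-idea-11
g13/g15, kernel-checked there), moved verbatim into the tree (statements of `def … : Prop` currencies UNFOLDED, as in the
line's earlier helpers). UNCONDITIONAL and kernel-checked; NOTHING is asserted about BSD, Mazur's main conjecture or IMC2.

WHAT.
* §D (commutative algebra) — along a pair `F ∘ G = c •`: `length_𝔮(M) ≤ length_𝔮(N)` for `c ∉ 𝔮`
  (`lengthAt_le_of_comp_eq_smul`), torsion transfer (`isTorsion_of_comp_eq_smul`); in `Λ = ℤ_p⟦T⟧`, `(d : Λ) ∉ 𝔮` for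
  `d ≠ 0` and a height-one `𝔮 ≠ (p)` (`natCast_notMem_of_height_eq_one_of_ne_augIdealP`).
* functoriality `Sel(g) ∘ Sel(f) = Sel(g ∘ f)`, congruence, `ker (G ∘ F)` finite from `ker F`, `ker G` finite; an isogeny
  of degree `1` and an isogeny of degree prime to `p` induce Selmer maps with FINITE (trivial) kernel
  (`H¹(H, E[p^∞])[ℓ] = 0` for `ℓ` prime to `p`, Bézout on cocycles).
* **K2⁺-e** (`xGrIsogenyInvariantAwayFromP`): for `ℚ`-isogenous `W₁ ∼ W₂` (elliptic, globally minimal), `p > 2`, an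
  imaginary quadratic `K` with the Heegner hypotheses of the line, `p = v v̄`, the CYCLOTOMIC `κ` and a topological
  generator `γ`: if `𝔛_Gr(W₁/K_∞⁺) = AcSelmer.XAc (W₁.baseChange K) p κ v̄ ∅ γ` is `Λ`-torsion then so is `𝔛_Gr(W₂/K_∞⁺)`,
  and the two have the same local length at every height-one prime `𝔮 ≠ (p)` — Greenberg's remark «the characteristic
  ideals … differ only by multiplication by a power of `p`» (LNM 1716 §1), kernel-checked via the transposes
  `ᵗφ ∘ ᵗφ̂ = deg φ` of the previous file.
References: Greenberg, LNM 1716 §1 and §5 (proof of Prop. 5.10); Silverman AEC Thm. III.6.1–6.2; Washington §13.2.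
-/

set_option linter.dupNamespace false
set_option autoImplicit false

noncomputable section

open scoped Classical

open WeierstrassCurve NumberField IsDedekindDomain Field
  Literature.NumberTheory.EllipticCurves Literature.NumberTheory.GaloisRepresentations
  Literature.NumberTheory.EllipticCurves.Rank1Residual
  Literature.NumberTheory.EllipticCurves.Castella2018 Literature.NumberTheory.QuadraticFields

namespace Summit.BirchSwinnertonDyer.BirchSwinnertonDyer.Theorems.InterludeWithTorsion

namespace K2e

open IsogenySelmerInfty GreenbergSelmer AcSelmer

/-! ## §D. Commutative algebra: transfer along a pair `F ∘ G = c`, and the bridge `(d : Λ) ∉ 𝔮` -/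

section Algebra

variable {R : Type*} [CommRing R] {M N : Type*} [AddCommGroup M] [Module R M] [AddCommGroup N]
  [Module R N]

/-- If `F ∘ G = c · id_M` with `c ∉ 𝔮`, then `length(M_𝔮) ≤ length(N_𝔮)` (the kernel of `G` is killed
by `c`; `Module.lengthAt_le_of_smul_ker_eq_zero`). [cite: Bourbaki1989CommAlg, Ch. II §2.4] -/
theorem lengthAt_le_of_comp_eq_smul (G : M →ₗ[R] N) (F : N →ₗ[R] M) {c : R}
    (𝔮 : PrimeSpectrum R) (hc : c ∉ 𝔮.asIdeal) (h : ∀ y, F (G y) = c • y) :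
    Module.lengthAt R M 𝔮 ≤ Module.lengthAt R N 𝔮 :=
  Module.lengthAt_le_of_smul_ker_eq_zero G 𝔮 hc fun y hy ↦ by rw [← h y, hy, map_zero]

/-- If `F ∘ G = c · id_M` with `c` a non-zero-divisor and `N` is torsion, then `M` is torsion.
[cite: Bourbaki1989CommAlg, Ch. II §2.4] -/
theorem isTorsion_of_comp_eq_smul (G : M →ₗ[R] N) (F : N →ₗ[R] M) {c : R}
    (hc : c ∈ nonZeroDivisors R) (h : ∀ y, F (G y) = c • y) (hN : Module.IsTorsion R N) :
    Module.IsTorsion R M := by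
  intro y
  obtain ⟨a, ha⟩ := @hN (G y)
  refine ⟨⟨c, hc⟩ * a, ?_⟩
  rw [Submonoid.smul_def, Submonoid.coe_mul, mul_smul, ← h (((a : nonZeroDivisors R) : R) • y),
    map_smul]
  change F ((a : R) • G y) = 0
  rw [← Submonoid.smul_def, ha, map_zero]

variable {p : ℕ} [Fact p.Prime]

/-- **`(d : Λ) ∉ 𝔮` for `d ≠ 0` and a height-one prime `𝔮 ≠ (p)` of `Λ = ℤ_p⟦T⟧`**: `d = p^a · u` with
`p ∤ u`, `C u` is a unit of `Λ`, and `C p ∈ 𝔮` would force `𝔮 = (p)`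
(`Kato2004.eq_augIdealP_of_height_eq_one_of_C_mem`). [cite: Washington1997, §13.2] -/
theorem natCast_notMem_of_height_eq_one_of_ne_augIdealP (𝔮 : PrimeSpectrum (IwasawaAlgebra p))
    (h1 : 𝔮.asIdeal.height = 1) (hne : 𝔮.asIdeal ≠ IwasawaAlgebra.augIdealP p) {d : ℕ} (hd : d ≠ 0) :
    ((d : ℕ) : IwasawaAlgebra p) ∉ 𝔮.asIdeal := by
  have hp𝔮 : (PowerSeries.C (p : ℤ_[p]) : IwasawaAlgebra p) ∉ 𝔮.asIdeal :=
    fun hmem ↦ hne (Kato2004.eq_augIdealP_of_height_eq_one_of_C_mem 𝔮 h1 hmem)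
  obtain ⟨a, u, hu, hN⟩ := Nat.exists_eq_pow_mul_and_not_dvd hd p (Fact.out : p.Prime).ne_one
  have hunit : IsUnit ((u : ℕ) : IwasawaAlgebra p) := by
    have hu' : IsUnit ((u : ℕ) : ℤ_[p]) := by
      rw [PadicInt.isUnit_iff]
      refine le_antisymm (PadicInt.norm_le_one _) (not_lt.mp fun hlt ↦ hu ?_)
      have hdvd := (PadicInt.norm_int_lt_one_iff_dvd (p := p) (u : ℤ)).mp (by exact_mod_cast hlt)
      exact_mod_cast hdvd
    have := hu'.map (PowerSeries.C (R := ℤ_[p]))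
    rwa [map_natCast] at this
  intro hmem
  rw [hN, Nat.cast_mul, Nat.cast_pow] at hmem
  have hCp : ((p : ℕ) : IwasawaAlgebra p) = PowerSeries.C (p : ℤ_[p]) := by rw [map_natCast]
  rw [hCp] at hmem
  rcases 𝔮.isPrime.mem_or_mem hmem with h | h
  · exact hp𝔮 (𝔮.isPrime.mem_of_pow_mem _ h)
  · exact 𝔮.isPrime.ne_top (Ideal.eq_top_of_isUnit_mem _ h hunit)

/-- `(d : Λ)` is a non-zero-divisor of the domain `Λ` for `d ≠ 0`. [folklore] -/
theorem natCast_mem_nonZeroDivisors {d : ℕ} (hd : d ≠ 0) :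
    ((d : ℕ) : IwasawaAlgebra p) ∈ nonZeroDivisors (IwasawaAlgebra p) := by
  refine mem_nonZeroDivisors_of_ne_zero ?_
  rw [← map_natCast (PowerSeries.C (R := ℤ_[p])) d]
  intro h0
  have : ((d : ℕ) : ℤ_[p]) = 0 := by
    have := congrArg PowerSeries.constantCoeff h0
    simpa using this
  exact hd (by exact_mod_cast this)

end Algebra

section Functoriality

variable {K : Type} [Field K] [NumberField K] {W W' W'' : WeierstrassCurve K} (p : ℕ) [Fact p.Prime]
  (κ : ZpExtension K p) (𝔭 : HeightOneSpectrum (𝓞 K)) (S : Set (HeightOneSpectrum (𝓞 K)))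

/-- **Functoriality `Sel(g) ∘ Sel(f) = Sel(g ∘ f)`** on Castella's Selmer groups over `K_∞` (from `h1Map_h1Map`).
[cite: SerreGaloisCohomology1997, I.§2.4 (functoriality of H¹ for compatible pairs)] -/
theorem acSelmerMap_acSelmerMap (f : W.geomPoints →+ W'.geomPoints)
    (hf : ∀ (σ : absoluteGaloisGroup K) (P : W.geomPoints), f (σ • P) = σ • f P)
    (g : W'.geomPoints →+ W''.geomPoints)
    (hg : ∀ (σ : absoluteGaloisGroup K) (Q : W'.geomPoints), g (σ • Q) = σ • g Q)
    (hgf : ∀ (σ : absoluteGaloisGroup K) (P : W.geomPoints), g.comp f (σ • P) = σ • g.comp f P)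
    (c : selmerAc W p κ 𝔭 S) :
    acSelmerMap p κ 𝔭 S g hg (acSelmerMap p κ 𝔭 S f hf c) = acSelmerMap p κ 𝔭 S (g.comp f) hgf c := by
  apply Subtype.ext
  rw [coe_acSelmerMap_apply, coe_acSelmerMap_apply, coe_acSelmerMap_apply]
  exact h1Map_h1Map p κ.kerSubgroup f hf g hg c

/-- `Sel(f)` depends only on the map `f` (congruence in the proof of equivariance and in `f`). [folklore] -/
theorem acSelmerMap_congr {f f' : W.geomPoints →+ W'.geomPoints} (h : f = f')
    (hf : ∀ (σ : absoluteGaloisGroup K) (P : W.geomPoints), f (σ • P) = σ • f P)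
    (hf' : ∀ (σ : absoluteGaloisGroup K) (P : W.geomPoints), f' (σ • P) = σ • f' P) :
    acSelmerMap p κ 𝔭 S f hf = acSelmerMap p κ 𝔭 S f' hf' := by
  subst h
  rfl

/-- **A composite of homomorphisms with finite kernels has finite kernel**: `ker (G ∘ F)` maps to `ker G` by `F`
with kernel inside `ker F`. [folklore] -/
theorem finite_ker_comp {A B C : Type*} [AddCommGroup A] [AddCommGroup B] [AddCommGroup C]
    (F : A →+ B) (G : B →+ C) (hF : Finite F.ker) (hG : Finite G.ker) : Finite (G.comp F).ker := by
  have hθ : ∀ c : (G.comp F).ker, (F.comp (G.comp F).ker.subtype) c ∈ G.ker := fun c ↦ by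
    have h := c.2
    rw [AddMonoidHom.mem_ker, AddMonoidHom.comp_apply] at h
    rw [AddMonoidHom.mem_ker]
    exact h
  let θ : (G.comp F).ker →+ G.ker := (F.comp (G.comp F).ker.subtype).codRestrict G.ker hθ
  have hθval : ∀ c : (G.comp F).ker, ((θ c : G.ker) : B) = F (c : A) := fun c ↦ rfl
  haveI : Finite θ.ker := by
    refine Finite.of_injective (fun z : θ.ker ↦ (⟨((z : (G.comp F).ker) : A), ?_⟩ : F.ker)) ?_
    · have hz : θ (z : (G.comp F).ker) = 0 := (AddMonoidHom.mem_ker).mp z.2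
      rw [AddMonoidHom.mem_ker, ← hθval, hz]
      rfl
    · intro z₁ z₂ h
      have h' : ((z₁ : (G.comp F).ker) : A) = ((z₂ : (G.comp F).ker) : A) := by
        simpa using congrArg Subtype.val h
      exact Subtype.ext (Subtype.ext h')
  haveI : Fintype θ.ker := Fintype.ofFinite _
  haveI : Fintype G.ker := Fintype.ofFinite _
  letI : Fintype (G.comp F).ker := AddGroup.fintypeOfKerOfCodom θ
  infer_instance

/-- **An isogeny of degree `1` induces an injective Selmer map** (it is a `Γ_K`-equivariant bijection on
`K̄`-points — injective as `#ker = 1`, surjective as every isogeny of elliptic curves, `Isogeny.surjective` — so its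
inverse `g` satisfies `g ∘ φ = [1]` and `Sel(g) ∘ Sel(φ) = 1`, `acSelmerMap_acSelmerMap_of_comp_eq_nsmul`); in
particular the kernel is finite. [cite: SilvermanAEC2009, Thm. II.2.3, Thm. III.4.10] -/
theorem finite_ker_acSelmerMap_of_bijective (φ : Isogeny W W') (hφ : Function.Bijective φ) :
    Finite (acSelmerMap p κ 𝔭 S φ.toAddMonoidHom φ.equivariant).ker := by
  set e : W.geomPoints ≃+ W'.geomPoints := AddEquiv.ofBijective φ.toAddMonoidHom hφ with he
  have he_apply : ∀ P, e P = φ P := fun P ↦ rfl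
  set g : W'.geomPoints →+ W.geomPoints := e.symm.toAddMonoidHom with hg
  have hgφ : ∀ P : W.geomPoints, g (φ P) = P := fun P ↦ by
    rw [hg, ← he_apply]
    exact e.symm_apply_apply P
  have hφg : ∀ Q : W'.geomPoints, φ (g Q) = Q := fun Q ↦ by
    rw [hg, ← he_apply]
    exact e.apply_symm_apply Q
  have hgeq : ∀ (σ : absoluteGaloisGroup K) (Q : W'.geomPoints), g (σ • Q) = σ • g Q := fun σ Q ↦ by
    apply hφ.1
    rw [hφg, Isogeny.map_smul, hφg]
  have h1 : ∀ P : W.geomPoints, g (φ.toAddMonoidHom P) = (((1 : ℕ) : ℤ)) • P := fun P ↦ by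
    rw [Nat.cast_one, one_zsmul]
    exact hgφ P
  have hinj : Function.Injective (acSelmerMap p κ 𝔭 S φ.toAddMonoidHom φ.equivariant) := by
    intro a b hab
    have ha := acSelmerMap_acSelmerMap_of_comp_eq_nsmul p κ 𝔭 S φ.toAddMonoidHom φ.equivariant g hgeq h1 a
    have hb := acSelmerMap_acSelmerMap_of_comp_eq_nsmul p κ 𝔭 S φ.toAddMonoidHom φ.equivariant g hgeq h1 b
    rw [one_nsmul] at ha hb
    rw [← ha, ← hb, hab]
  haveI : Subsingleton (acSelmerMap p κ 𝔭 S φ.toAddMonoidHom φ.equivariant).ker := ⟨fun a b ↦ by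
    apply Subtype.ext
    apply hinj
    have ha := a.2
    have hb := b.2
    rw [AddMonoidHom.mem_ker] at ha hb
    rw [ha, hb]⟩
  infer_instance


omit [NumberField K] [Fact p.Prime] in
/-- **`H¹(H, E[p^∞])[ℓ] = 0` for `ℓ` prime to `p` (PROVED, REV 8.5)**: if `ℓ • c = 0`, a cocycle `a` of `c` has `ℓ a = ∂v`
(`oneCocycleClass_eq_zero_iff`); with `p^k v = 0` and Bézout `u ℓ + w p^k = 1`, `a = ∂(u v)` since `ℓ •` is injective on `E[p^∞]`.
[cite: SilvermanAEC2009, App. B §2] [folklore] -/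
theorem subgroupH1_eq_zero_of_coprime_nsmul (H : Subgroup (absoluteGaloisGroup K)) {ℓ : ℕ}
    (hℓ : ℓ.Coprime p) (c : W.subgroupH1 p H) (hc : ℓ • c = 0) : c = 0 := by
  -- `ℓ •` is injective on `E[p^∞]`: Bézout against the `p`-power killing the element
  have hinj : ∀ m m' : geomPrimaryTorsion W p, (ℓ : ℤ) • m = (ℓ : ℤ) • m' → m = m' := by
    intro m m' hmm'
    rw [← sub_eq_zero] at hmm' ⊢
    rw [← smul_sub] at hmm'
    set d := m - m' with hd
    obtain ⟨k, hk⟩ := AddCommGroup.mem_primaryComponent.mp d.2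
    obtain ⟨u, w, huw⟩ := Nat.isCoprime_iff_coprime.mpr (hℓ.pow_right k)
    apply Subtype.ext
    have hℓd : (ℓ : ℤ) • (d : W.geomPoints) = 0 := by
      have := congrArg Subtype.val hmm'
      simpa using this
    have hkd : ((p ^ k : ℕ) : ℤ) • (d : W.geomPoints) = 0 := by
      rw [natCast_zsmul]; exact hk
    calc (d : W.geomPoints) = (1 : ℤ) • (d : W.geomPoints) := (one_zsmul _).symm
      _ = (u * (ℓ : ℤ) + w * ((p ^ k : ℕ) : ℤ)) • (d : W.geomPoints) := by rw [huw]
      _ = 0 := by rw [add_smul, mul_smul, mul_smul, hℓd, hkd, smul_zero, smul_zero, add_zero]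
  set X := discreteTopRep H (geomPrimaryTorsion W p) with hX
  obtain ⟨a, rfl⟩ := oneCocycleClass_surjective X c
  have hs : oneCocycleClass X ((ℓ : ℤ) • a) = ℓ • oneCocycleClass X a := by
    rw [oneCocycleClass_smul, Nat.cast_smul_eq_nsmul]
  rw [← hs] at hc
  obtain ⟨v, hv⟩ := (oneCocycleClass_eq_zero_iff X _).mp hc
  obtain ⟨k, hk⟩ := AddCommGroup.mem_primaryComponent.mp (v : geomPrimaryTorsion W p).2
  obtain ⟨u, w, huw⟩ := Nat.isCoprime_iff_coprime.mpr (hℓ.pow_right k)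
  refine (oneCocycleClass_eq_zero_iff X a).mpr ⟨u • v, fun g => ?_⟩
  apply hinj
  have hvg : (ℓ : ℤ) • (a.1 g : geomPrimaryTorsion W p) =
      g • (v : geomPrimaryTorsion W p) - (v : geomPrimaryTorsion W p) := hv g
  rw [hvg]
  change _ = (ℓ : ℤ) • (g • (u • (v : geomPrimaryTorsion W p)) - u • (v : geomPrimaryTorsion W p))
  have hℓu : (ℓ : ℤ) • (u • (v : geomPrimaryTorsion W p)) = v := by
    have hkv : ((p ^ k : ℕ) : ℤ) • (v : geomPrimaryTorsion W p) = 0 := by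
      apply Subtype.ext
      rw [AddSubgroupClass.coe_zsmul, natCast_zsmul, hk]
      rfl
    have h1 : ((ℓ : ℤ) * u) = 1 - w * ((p ^ k : ℕ) : ℤ) := by rw [← huw]; ring
    rw [← mul_smul, h1, sub_smul, one_smul, mul_smul, hkv, smul_zero, sub_zero]
  rw [smul_sub, smul_comm (ℓ : ℤ) g, hℓu]

/-- **The `ℓ ≠ p` case of (B1c), PROVED (REV 8.5; critic V86 N2)**: for an isogeny `φ` over `K` of degree prime to `p`, `Sel_𝔭^Σ(φ)` has
trivial, hence FINITE, kernel — `φ̂ φ = [deg φ]` (`Isogeny.exists_dual_of_isElliptic`), `Sel(φ̂) ∘ Sel(φ) = deg φ •`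
(`acSelmerMap_acSelmerMap_of_comp_eq_nsmul`), and `subgroupH1_eq_zero_of_coprime_nsmul`. [cite: SilvermanAEC2009, Thm. III.6.2] [cite: GreenbergLNM1716, §5, proof of Prop. 5.10] -/
theorem finite_ker_acSelmerMap_of_coprime [W.IsElliptic] [W'.IsElliptic] (φ : Isogeny W W')
    (hcop : φ.degree.Coprime p) : Finite (acSelmerMap p κ 𝔭 S φ.toAddMonoidHom φ.equivariant).ker := by
  obtain ⟨ψ, hψ⟩ := φ.exists_dual_of_isElliptic
  have key : ∀ c : selmerAc W p κ 𝔭 S, acSelmerMap p κ 𝔭 S φ.toAddMonoidHom φ.equivariant c = 0 → c = 0 := by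
    intro c hc
    have h := acSelmerMap_acSelmerMap_of_comp_eq_nsmul p κ 𝔭 S φ.toAddMonoidHom φ.equivariant ψ.toAddMonoidHom
      ψ.equivariant (n := φ.degree) (fun P ↦ hψ P) c
    rw [hc, map_zero] at h
    have h' : φ.degree • (c : W.subgroupH1 p κ.kerSubgroup) = 0 := by
      rw [← AddSubgroupClass.coe_nsmul, ← h]
      rfl
    exact Subtype.ext (subgroupH1_eq_zero_of_coprime_nsmul p κ.kerSubgroup hcop _ h')
  haveI : Subsingleton (acSelmerMap p κ 𝔭 S φ.toAddMonoidHom φ.equivariant).ker := ⟨fun a b ↦ by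
    apply Subtype.ext
    rw [key a.1 ((AddMonoidHom.mem_ker).mp a.2), key b.1 ((AddMonoidHom.mem_ker).mp b.2)]⟩
  infer_instance


end Functoriality

end K2e


/-- **K2⁺-e — ISOGENY INVARIANCE OF `𝔛_Gr(·/K_∞⁺)` AWAY FROM `(p)` (kernel-checked).** Along a `ℚ`-isogeny
`φ : W₁ → W₂` base-changed to `K`, with `ψ = φ̂`, `χ = ψ̂` (`Isogeny.exists_dual_of_isElliptic`), the `Λ`-linear
transposes of `Sel_v̄(·)` satisfy `ᵗφ ∘ ᵗψ = deg φ` on `𝔛₁` and `ᵗψ ∘ ᵗχ = deg ψ` on `𝔛₂`; since `(deg : Λ) ∉ 𝔮` at every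
height-one `𝔮 ≠ (p)`, the local lengths agree and `Λ`-torsion passes from `𝔛₁` to `𝔛₂`. Statement = the line's currency
`XGrIsogenyInvariantAwayFromP` unfolded (only `IsIsogenous W₁ W₂` is used; the other binders are those of the line's K2⁺).
[cite: GreenbergLNM1716, §1 (paragraph before Conj. 1.11)] [cite: SilvermanAEC2009, Thm. III.6.1(a)]
[cite: Castella2018, Def. 2.2 (arXiv:1704.06608 p. 5)] -/
theorem xGrIsogenyInvariantAwayFromP :
    ∀ (W₁ W₂ : WeierstrassCurve ℚ) [W₁.IsElliptic] [W₁.IsGloballyMinimal] [W₂.IsElliptic]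
      [W₂.IsGloballyMinimal] (p : ℕ) [Fact p.Prime],
      2 < p → W₁.HasGoodReductionAtPrime p → IsIsogenous W₁ W₂ →
      ∀ (K : Type) [Field K] [NumberField K], IsImaginaryQuadratic K →
        SatisfiesHeegnerHypothesis (W₁.conductorNorm ℤ) K → SatisfiesHeegnerHypothesis p K →
        Odd (NumberField.discr K) → NumberField.discr K ≠ -3 →
      ∀ (v vbar : HeightOneSpectrum (𝓞 K)),
        ((p : ℕ) : 𝓞 K) ∈ v.asIdeal → ((p : ℕ) : 𝓞 K) ∈ vbar.asIdeal → vbar ≠ v →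
      ∀ (κ : ZpExtension K p), κ.IsCyclotomic →
      ∀ (γ : absoluteGaloisGroup K) [Fact (κ.IsTopGenerator γ)],
        Module.IsTorsion (IwasawaAlgebra p) (AcSelmer.XAc (W₁.baseChange K) p κ vbar ∅ γ) →
        Module.IsTorsion (IwasawaAlgebra p) (AcSelmer.XAc (W₂.baseChange K) p κ vbar ∅ γ) ∧
        ∀ 𝔮 : PrimeSpectrum (IwasawaAlgebra p), 𝔮.asIdeal.height = 1 →
          𝔮.asIdeal ≠ IwasawaAlgebra.augIdealP p →
          Literature.NumberTheory.EllipticCurves.Module.lengthAt (IwasawaAlgebra p)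
              (AcSelmer.XAc (W₁.baseChange K) p κ vbar ∅ γ) 𝔮 =
            Literature.NumberTheory.EllipticCurves.Module.lengthAt (IwasawaAlgebra p)
              (AcSelmer.XAc (W₂.baseChange K) p κ vbar ∅ γ) 𝔮 := by
  intro W₁ W₂ _ _ _ _ p _ _hp _hgood hiso K _ _ _hK _hH1 _hHp _hodd _hd3 v vbar _hv _hvbar _hne κ _hcyc
    γ _ htors
  haveI : (W₁.baseChange K).IsElliptic := inferInstanceAs ((W₁.map (algebraMap ℚ K)).IsElliptic)
  haveI : (W₂.baseChange K).IsElliptic := inferInstanceAs ((W₂.map (algebraMap ℚ K)).IsElliptic)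
  obtain ⟨φ⟩ := (hiso.extendScalars K : IsIsogenous (W₁.baseChange K) (W₂.baseChange K))
  obtain ⟨ψ, hψ⟩ := φ.exists_dual_of_isElliptic
  obtain ⟨χ, hχ⟩ := ψ.exists_dual_of_isElliptic
  obtain ⟨Tφ, hTφ⟩ := K2e.exists_transpose p κ vbar ∅ γ φ.toAddMonoidHom φ.equivariant
  obtain ⟨Tψ, hTψ⟩ := K2e.exists_transpose p κ vbar ∅ γ ψ.toAddMonoidHom ψ.equivariant
  obtain ⟨Tχ, hTχ⟩ := K2e.exists_transpose p κ vbar ∅ γ χ.toAddMonoidHom χ.equivariant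
  have h1 : ∀ y : AcSelmer.XAc (W₁.baseChange K) p κ vbar ∅ γ,
      Tφ (Tψ y) = ((φ.degree : ℕ) : IwasawaAlgebra p) • y :=
    K2e.transpose_comp_eq_smul p κ vbar ∅ γ φ.toAddMonoidHom φ.equivariant ψ.toAddMonoidHom
      ψ.equivariant (fun P ↦ hψ P) Tφ hTφ Tψ hTψ
  have h2 : ∀ x : AcSelmer.XAc (W₂.baseChange K) p κ vbar ∅ γ,
      Tψ (Tχ x) = ((ψ.degree : ℕ) : IwasawaAlgebra p) • x :=
    K2e.transpose_comp_eq_smul p κ vbar ∅ γ ψ.toAddMonoidHom ψ.equivariant χ.toAddMonoidHom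
      χ.equivariant (fun P ↦ hχ P) Tψ hTψ Tχ hTχ
  refine ⟨K2e.isTorsion_of_comp_eq_smul Tχ Tψ (K2e.natCast_mem_nonZeroDivisors ψ.degree_pos.ne') h2
      htors, fun 𝔮 h𝔮 hne𝔮 ↦ le_antisymm ?_ ?_⟩
  · exact K2e.lengthAt_le_of_comp_eq_smul Tψ Tφ 𝔮
      (K2e.natCast_notMem_of_height_eq_one_of_ne_augIdealP 𝔮 h𝔮 hne𝔮 φ.degree_pos.ne') h1
  · exact K2e.lengthAt_le_of_comp_eq_smul Tχ Tψ 𝔮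
      (K2e.natCast_notMem_of_height_eq_one_of_ne_augIdealP 𝔮 h𝔮 hne𝔮 ψ.degree_pos.ne') h2

end Summit.BirchSwinnertonDyer.BirchSwinnertonDyer.Theorems.InterludeWithTorsion

end
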